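import Literature.MathematicalPhysics.QuantumManyBody.ScatteringLengthTruncationHardCore
import HarnessLib

/-!
# Route BECPhaseQuadratureSumRule — `SmoothPartner`, helper: scattering length vs. coupling

Helper file for item stmt-AtomisticToContinuum-12628 (`SmoothPartner`). For a family `s ↦ s f`
(`f ≥ 0` real) the scattering length `a(s f)` is monotone in `s`, satisfies
`a(s' f) ≤ (s'/s) a(s f)` for `0 < s ≤ s'` (the Lieb–Yngvason functional is affine in the
potential), and `a(s f) ≤ s (4π)⁻¹ ½∫f(|x|)dx` (Spruch–Rosenberg); hence, when `a(s f)` is bounded,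
`s ↦ a(s f)` is continuous on `(0, ∞)` and takes every value between `a(s₁ f)` and `a(s₂ f)`
(intermediate value theorem). Also: monotonicity of `a` under comparison of the profiles on
`(0, ∞)` only.
-/

noncomputable section

open MeasureTheory Set Filter Topology Metric
open scoped ENNReal NNReal

namespace Summit.AtomisticToContinuum.BoseEinsteinCondensation.Theorems

open Literature.MathematicalPhysics.QuantumManyBody.BoseGas

/-! ### The scattering length as a function of the coupling constant -/

/-- Comparison `a(w) ≤ c·a(v)` when `w ≤ c v` pointwise and `c ≥ 1`: the scattering functional is
affine in the potential, `𝓔_w[φ] ≤ c 𝓔_v[φ]`. [cite: LSSY2005, App. C Thm. C.1] -/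
theorem scatteringLength_le_mul_of_le_mul {v w : ℝ → ℝ≥0∞} {c : ℝ≥0∞} (hc1 : 1 ≤ c)
    (hc : c ≠ ⊤) (h : ∀ r, w r ≤ c * v r) :
    scatteringLength w ≤ c * scatteringLength v := by
  have hc0 : c ≠ 0 := (zero_lt_one.trans_le hc1).ne'
  unfold scatteringLength
  rw [mul_left_comm, ENNReal.mul_iInf_of_ne hc0 hc]
  gcongr _ * ?_
  refine iInf_mono fun φ => ?_
  rw [ENNReal.mul_iInf_of_ne hc0 hc]
  refine iInf_mono fun _ => ?_
  calc scatteringFunctional w φ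
      ≤ ∫⁻ x, c * (gradSq φ x + 2⁻¹ * v ‖x‖ * (‖φ x‖₊ : ℝ≥0∞) ^ 2) := by
        refine lintegral_mono fun x => ?_
        calc gradSq φ x + 2⁻¹ * w ‖x‖ * (‖φ x‖₊ : ℝ≥0∞) ^ 2
            ≤ c * gradSq φ x + 2⁻¹ * (c * v ‖x‖) * (‖φ x‖₊ : ℝ≥0∞) ^ 2 :=
              add_le_add (le_mul_of_one_le_left zero_le hc1) (by gcongr; exact h _)
          _ = c * (gradSq φ x + 2⁻¹ * v ‖x‖ * (‖φ x‖₊ : ℝ≥0∞) ^ 2) := by ring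
    _ = c * scatteringFunctional v φ := lintegral_const_mul' c _ hc

/-- Monotonicity of the scattering length needs the comparison of the profiles only on `(0, ∞)`
(the functional sees `v(|x|)`, and the origin is a null set). [cite: LSSY2005, App. C Lemma C.2] -/
theorem scatteringLength_mono_Ioi {v w : ℝ → ℝ≥0∞} (h : ∀ r, 0 < r → v r ≤ w r) :
    scatteringLength v ≤ scatteringLength w := by
  rw [scatteringLength_congr_Ioi (v₁ := v) (v₂ := fun r => if 0 < r then v r else 0)
    (fun r hr => by rw [if_pos hr])]
  refine scatteringLength_mono fun r => ?_
  by_cases hr : 0 < r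
  · rw [if_pos hr]; exact h r hr
  · rw [if_neg hr]; exact zero_le

/-- `s ↦ a(s f)` is monotone (`f ≥ 0`). [cite: LSSY2005, App. C Lemma C.2] -/
theorem scatteringLength_smul_mono {f : ℝ → ℝ} (hf : ∀ r, 0 ≤ f r) {s s' : ℝ} (h : s ≤ s') :
    scatteringLength (fun r => ENNReal.ofReal (s * f r)) ≤
      scatteringLength (fun r => ENNReal.ofReal (s' * f r)) :=
  scatteringLength_mono fun r => ENNReal.ofReal_le_ofReal (mul_le_mul_of_nonneg_right h (hf r))

/-- `a(s' f) ≤ (s'/s) a(s f)` for `0 < s ≤ s'` (`s ↦ a(s f)/s` is non-increasing: the scattering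
functional is affine in `s`). [cite: LSSY2005, App. C Thm. C.1] -/
theorem scatteringLength_smul_le_mul {f : ℝ → ℝ} (hf : ∀ r, 0 ≤ f r) {s s' : ℝ} (hs : 0 < s)
    (h : s ≤ s') :
    scatteringLength (fun r => ENNReal.ofReal (s' * f r)) ≤
      ENNReal.ofReal (s' / s) * scatteringLength (fun r => ENNReal.ofReal (s * f r)) := by
  refine scatteringLength_le_mul_of_le_mul (ENNReal.one_le_ofReal.2 ((one_le_div hs).2 h))
    ENNReal.ofReal_ne_top fun r => ?_
  rw [← ENNReal.ofReal_mul (div_nonneg (hs.le.trans h) hs.le)]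
  refine ENNReal.ofReal_le_ofReal (le_of_eq ?_)
  have := hf r
  field_simp

/-- Spruch–Rosenberg for the family: `a(s f) ≤ s · (4π)⁻¹ · ½ ∫ f(|x|) dx`.
[cite: LSSY2005, App. C (C.10)] -/
theorem scatteringLength_smul_le {f : ℝ → ℝ} {s : ℝ} (hs : 0 ≤ s) :
    scatteringLength (fun r => ENNReal.ofReal (s * f r)) ≤
      ENNReal.ofReal s * ((ENNReal.ofReal (4 * Real.pi))⁻¹ *
        (2⁻¹ * ∫⁻ x : Space, ENNReal.ofReal (f ‖x‖))) := by
  have h4 : ENNReal.ofReal (4 * Real.pi) ≠ 0 := by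
    rw [ENNReal.ofReal_ne_zero_iff]; positivity
  have hb := four_pi_mul_scatteringLength_le (fun r => ENNReal.ofReal (s * f r))
  have hint : ∫⁻ x : Space, 2⁻¹ * ENNReal.ofReal (s * f ‖x‖) =
      ENNReal.ofReal s * (2⁻¹ * ∫⁻ x : Space, ENNReal.ofReal (f ‖x‖)) := by
    rw [← lintegral_const_mul' _ _ (ENNReal.inv_ne_top.2 two_ne_zero),
      ← lintegral_const_mul' _ _ ENNReal.ofReal_ne_top]
    refine lintegral_congr fun x => ?_
    rw [ENNReal.ofReal_mul hs]
    ring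
  calc scatteringLength (fun r => ENNReal.ofReal (s * f r))
      = (ENNReal.ofReal (4 * Real.pi))⁻¹ *
          (ENNReal.ofReal (4 * Real.pi) *
            scatteringLength (fun r => ENNReal.ofReal (s * f r))) := by
        rw [← mul_assoc, ENNReal.inv_mul_cancel h4 ENNReal.ofReal_ne_top, one_mul]
    _ ≤ (ENNReal.ofReal (4 * Real.pi))⁻¹ *
          (ENNReal.ofReal s * (2⁻¹ * ∫⁻ x : Space, ENNReal.ofReal (f ‖x‖))) := by
        gcongr _ * ?_
        exact hb.trans_eq hint
    _ = _ := by rw [mul_left_comm]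

/-- **Continuity of `s ↦ a(s f)` on `(0, ∞)`** for a family with bounded scattering length
(`a(s f) ≤ B`): from monotonicity and `a(s' f) ≤ (s'/s) a(s f)` one gets the local Lipschitz bound
`|a(s f) − a(s₀ f)| ≤ (2B/s₀)|s − s₀|` for `|s − s₀| < s₀/2`. [cite: LSSY2005, App. C Thm. C.1] -/
theorem continuousAt_toReal_scatteringLength_smul {f : ℝ → ℝ} (hf : ∀ r, 0 ≤ f r) {B : ℝ}
    (hB0 : 0 ≤ B)
    (hB : ∀ s, scatteringLength (fun r => ENNReal.ofReal (s * f r)) ≤ ENNReal.ofReal B)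
    {s₀ : ℝ} (hs₀ : 0 < s₀) :
    ContinuousAt (fun s => (scatteringLength (fun r => ENNReal.ofReal (s * f r))).toReal) s₀ := by
  set g : ℝ → ℝ := fun s => (scatteringLength (fun r => ENNReal.ofReal (s * f r))).toReal
    with hg_def
  have hne : ∀ s, scatteringLength (fun r => ENNReal.ofReal (s * f r)) ≠ ⊤ :=
    fun s => ne_top_of_le_ne_top ENNReal.ofReal_ne_top (hB s)
  have hgB : ∀ s, g s ≤ B := fun s => ENNReal.toReal_le_of_le_ofReal hB0 (hB s)
  have hg0 : ∀ s, 0 ≤ g s := fun s => ENNReal.toReal_nonneg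
  have hmono : ∀ s s', s ≤ s' → g s ≤ g s' :=
    fun s s' hss' => ENNReal.toReal_mono (hne s') (scatteringLength_smul_mono hf hss')
  have hratio : ∀ s s', 0 < s → s ≤ s' → g s' * s ≤ s' * g s := by
    intro s s' hs hss'
    have h1 := scatteringLength_smul_le_mul hf hs hss'
    have h2 := ENNReal.toReal_mono (ENNReal.mul_ne_top ENNReal.ofReal_ne_top (hne s)) h1
    rw [ENNReal.toReal_mul, ENNReal.toReal_ofReal (div_nonneg (hs.le.trans hss') hs.le)] at h2
    have h3 := mul_le_mul_of_nonneg_right h2 hs.le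
    calc g s' * s ≤ s' / s * (scatteringLength fun r => ENNReal.ofReal (s * f r)).toReal * s := h3
      _ = s' * g s := by simp only [hg_def]; field_simp
  refine continuousAt_of_locally_lipschitz (half_pos hs₀) (2 * B / s₀) fun s hs => ?_
  simp only [Real.dist_eq] at hs ⊢
  have hs_lo : s₀ / 2 < s := by linarith [(abs_lt.mp hs).1]
  have hs_pos : 0 < s := by linarith
  rcases le_total s s₀ with h | h
  · have h1 := hratio s s₀ hs_pos h
    have h2 := hmono s s₀ h
    rw [abs_of_nonpos (sub_nonpos.2 h2), abs_of_nonpos (sub_nonpos.2 h), neg_sub, neg_sub,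
      div_mul_eq_mul_div, le_div_iff₀ hs₀]
    nlinarith [mul_nonneg (sub_nonneg.2 h2) (by linarith : (0 : ℝ) ≤ 2 * s - s₀),
      mul_nonneg (sub_nonneg.2 h) (sub_nonneg.2 (hgB s))]
  · have h1 := hratio s₀ s hs₀ h
    have h2 := hmono s₀ s h
    rw [abs_of_nonneg (sub_nonneg.2 h2), abs_of_nonneg (sub_nonneg.2 h),
      div_mul_eq_mul_div, le_div_iff₀ hs₀]
    nlinarith [mul_nonneg (sub_nonneg.2 h) (sub_nonneg.2 (hgB s₀)),
      mul_nonneg (sub_nonneg.2 h) hB0]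

/-- **Intermediate value theorem for `s ↦ a(s f)`**: if `a(s₁ f) ≤ A ≤ a(s₂ f)` with `s₁ > 0`,
then `a(s f) = A` for some `s > 0`. [cite: LSSY2005, App. C Thm. C.1] -/
theorem exists_toReal_scatteringLength_smul_eq {f : ℝ → ℝ} (hf : ∀ r, 0 ≤ f r) {B : ℝ}
    (hB0 : 0 ≤ B)
    (hB : ∀ s, scatteringLength (fun r => ENNReal.ofReal (s * f r)) ≤ ENNReal.ofReal B)
    {A s₁ s₂ : ℝ} (hs₁ : 0 < s₁)
    (h₁ : (scatteringLength (fun r => ENNReal.ofReal (s₁ * f r))).toReal ≤ A)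
    (h₂ : A ≤ (scatteringLength (fun r => ENNReal.ofReal (s₂ * f r))).toReal) :
    ∃ s, 0 < s ∧ (scatteringLength (fun r => ENNReal.ofReal (s * f r))).toReal = A := by
  set g : ℝ → ℝ := fun s => (scatteringLength (fun r => ENNReal.ofReal (s * f r))).toReal
    with hg_def
  have hne : ∀ s, scatteringLength (fun r => ENNReal.ofReal (s * f r)) ≠ ⊤ :=
    fun s => ne_top_of_le_ne_top ENNReal.ofReal_ne_top (hB s)
  have h₃ : A ≤ g (max s₁ s₂) :=
    h₂.trans (ENNReal.toReal_mono (hne _) (scatteringLength_smul_mono hf (le_max_right _ _)))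
  have hcont : ContinuousOn g (Icc s₁ (max s₁ s₂)) :=
    continuousOn_of_forall_continuousAt fun s hs =>
      continuousAt_toReal_scatteringLength_smul hf hB0 hB (hs₁.trans_le hs.1)
  obtain ⟨s, hs, hgs⟩ := intermediate_value_Icc (le_max_left s₁ s₂) hcont ⟨h₁, h₃⟩
  exact ⟨s, hs₁.trans_le hs.1, hgs⟩

end Summit.AtomisticToContinuum.BoseEinsteinCondensation.Theorems

end
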